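import Summits.CriticalPhenomena.PercolationContinuityZ3.Theorems.PercNearOneGluingNoHeavyLowerTailObserverExchange
import Summits.CriticalPhenomena.PercolationContinuityZ3.Theorems.PercNearOneGluingAdditiveGluingKnLemma2
import Summits.CriticalPhenomena.PercolationContinuityZ3.Theorems.PercNearOneGluingNoHeavyLowerTailSectorTransfer
import HarnessLib

/-!
# `NoHeavyLowerTail` (stmt-CriticalPhenomena-4575) — three relays: KN Question 7 at `|A| = 3` from two HYPOTHESIS-FREE
# covariance comparisons on the two-point world `{a₁ ↮ a₃}`  (depth prover `nh-dp-commonrelay`, gen 7)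

Support file (`--supports stmt-CriticalPhenomena-4575`); no definitions, no named facts, no sorries.  Continues
`…ObserverExchange` (pre-FKG (3) at `a₃` ⟸ the observer-exchange row `[K]`).  Here `[K]` itself is reduced to two
inequalities that carry NO hypothesis on the order of the `τ_j = μ(a_j ↔ b)`: with `N₁₃ = {a₁ ↮ a₃}` (a van den
Berg–Häggström–Kahn world: clusters of `a₁` and `a₃`), `φ₂ = μ(N₂ ∩ {a₂↔o})/μ(N₂)`, `N₂ = {a₂ ↮ a₁, a₃}`, and
`Y := 1{o ↔ a₁} − φ₂ · 1{a₁ ↔ a₂}`,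
  (K*g)  `Cov_{N₁₃}(Y, 1{b ∈ C(a₁)}) ≥ 0`,        (K*t)  `Cov_{N₁₃}(Y, 1{a₃ ↔ b}) ≤ 0`
(division-free forms = the registered stubs `stub_covCompThreeRelaysG`, `stub_covCompThreeRelaysT`).  In words: in the world where
`a₁` and `a₃` are separated, the observer's attachment to `a₁` co-varies with `b`'s attachment (to `a₁`, resp. to `a₃`) at least
`φ₂` times as strongly as the second relay's attachment does.  MECHANISM (`preFKG3_of_covComp`): writing `L₁(Q) = μ(Q,a₁↔b) − μ(Q,a₃↔b)`,
`[K]/μ(N₁₃) = E₁₃[(Y − φ₁)(g − t)] = Cov₁₃(Y, g) − Cov₁₃(Y, t) + (E₁₃[Y] − φ₁) · E₁₃[g − t]`, where `E₁₃[g − t] = (τ₁ − τ₃)/μ(N₁₃) ≥ 0`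
is the ONLY use of the minimiser hypothesis and `E₁₃[Y] − φ₁ = μ(W₃)/μ(N₁₃) · (φ₁₂^{W₃} − φ₁ − φ₂) ≥ 0` is KN Lemma 1 + Lemma 2
(BHK Thm 1.3 on `N₁₂` for `φ₁₂^{W₃} ≥ φ₁₂`, and `stub_knLemma2` for `φ₁₂ ≥ φ₁ + φ₂`).  Numerics (memo RESIDUAL-gen7.md §7): (K*g), (K*t)
0 violations on 4 104 random labellings of ALL τ-orders and under adversarial multi-scale descent; they are tight at the o-glued family.
Contents: set/measure bookkeeping on `N₁₃`, `cc_lemma12` (`P₁ P₂ μ(W₃ ∩ O) ≥ (A₁ P₂ + A₂ P₁) μ(W₃)`), the arithmetic, the assembly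
`preFKG3_of_covComp` and `preFKG3_of_stubCovComp` (registered stubs verbatim).
[cite: KozmaNitzan2024, Theorem 2 (§3.1, pp. 8–9), Lemmas 1–3 (pp. 5–7), Question 7 (§5.5, p. 36); VandenbergHaggstromKahn2005, Thms. 1.3–1.4]
-/

namespace Summit.CriticalPhenomena.PercolationContinuityZ3.Theorems

open MeasureTheory Set Literature.Probability.LatticeModels Literature.Probability.Percolation

noncomputable section
open Classical

variable {n : ℕ}

/-! ### Bookkeeping on `N₁₃ = {a₁ ↮ a₃}` -/

/-- On `{a₁ ↔ a₃}`, `{a₁↔b} = {a₃↔b}`. [folklore] -/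
theorem cc_set_tau (b a₁ a₃ : Fin n) :
    (openConn a₁ b ∩ openConn a₁ a₃ : Set (BondConfig (Fin n))) = openConn a₃ b ∩ openConn a₁ a₃ := by
  ext ω
  simp only [Set.mem_inter_iff, knThm2_mem_openConn]
  constructor
  · rintro ⟨h1b, h13⟩
    exact ⟨h13.symm.trans h1b, h13⟩
  · rintro ⟨h3b, h13⟩
    exact ⟨h13.trans h3b, h13⟩

/-- `τ₁ − τ₃ = μ(N₁₃ ∩ {a₁↔b}) − μ(N₁₃ ∩ {a₃↔b})`. [folklore] -/
theorem cc_tau_sub (w : Sym2 (Fin n) → unitInterval) (b a₁ a₃ : Fin n) :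
    (prodBernoulli w).real (openConn a₁ b) - (prodBernoulli w).real (openConn a₃ b) =
      (prodBernoulli w).real ((openConn a₁ b : Set (BondConfig (Fin n))) \ openConn a₁ a₃) -
        (prodBernoulli w).real ((openConn a₃ b : Set (BondConfig (Fin n))) \ openConn a₁ a₃) := by
  have hm : ∀ s : Set (BondConfig (Fin n)), MeasurableSet s := fun _ => MeasurableSet.of_discrete
  have h1 := measureReal_inter_add_sdiff (μ := prodBernoulli w) (s := (openConn a₁ b : Set (BondConfig (Fin n))))
    (hm (openConn a₁ a₃))
  have h3 := measureReal_inter_add_sdiff (μ := prodBernoulli w) (s := (openConn a₃ b : Set (BondConfig (Fin n))))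
    (hm (openConn a₁ a₃))
  rw [cc_set_tau] at h1
  linarith

/-- `L₁({o↔a₁}) = μ(N₁₃ ∩ {a₁↔o} ∩ {a₁↔b}) − μ(N₁₃ ∩ {a₁↔o} ∩ {a₃↔b})`. [folklore] -/
theorem cc_L1_sub (w : Sym2 (Fin n) → unitInterval) (o b a₁ a₃ : Fin n) :
    (prodBernoulli w).real (openConn a₁ o ∩ openConn a₁ b) - (prodBernoulli w).real (openConn a₁ o ∩ openConn a₃ b) =
      (prodBernoulli w).real ((openConn a₁ o ∩ openConn a₁ b : Set (BondConfig (Fin n))) \ openConn a₁ a₃) -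
        (prodBernoulli w).real ((openConn a₁ o ∩ openConn a₃ b : Set (BondConfig (Fin n))) \ openConn a₁ a₃) := by
  have hm : ∀ s : Set (BondConfig (Fin n)), MeasurableSet s := fun _ => MeasurableSet.of_discrete
  have h1 := measureReal_inter_add_sdiff (μ := prodBernoulli w) (s := (openConn a₁ o ∩ openConn a₁ b : Set (BondConfig (Fin n))))
    (hm (openConn a₁ a₃))
  have h3 := measureReal_inter_add_sdiff (μ := prodBernoulli w) (s := (openConn a₁ o ∩ openConn a₃ b : Set (BondConfig (Fin n))))
    (hm (openConn a₁ a₃))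
  rw [obs_setB0] at h3
  linarith

/-- Rewriting `s \ {a₁↔a₃}` as `N₁₃ ∩ s`. [folklore] -/
theorem cc_sdiff_eq (s : Set (BondConfig (Fin n))) (a₁ a₃ : Fin n) :
    s \ openConn a₁ a₃ = (openConn a₁ a₃)ᶜ ∩ s := by
  ext ω
  simp only [Set.mem_sdiff, Set.mem_inter_iff, Set.mem_compl_iff]
  tauto

/-- `N₁₃ ∩ {a₁↔a₂} ∩ {a₃↔b} = N₁₂ ∩ {a₁↔a₂} ∩ {a₃↔b}` (the glued-world pattern `m₃^{W₃}`). [folklore] -/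
theorem cc_set_Jt (b a₁ a₂ a₃ : Fin n) :
    ((openConn a₁ a₃)ᶜ ∩ (openConn a₁ a₂ ∩ openConn a₃ b) : Set (BondConfig (Fin n))) =
      (openConn a₁ a₃)ᶜ ∩ (openConn a₂ a₃)ᶜ ∩ (openConn a₁ a₂ ∩ openConn a₃ b) := by
  ext ω
  simp only [Set.mem_inter_iff, Set.mem_compl_iff, knThm2_mem_openConn]
  constructor
  · rintro ⟨h13, h12, h3b⟩
    exact ⟨⟨h13, fun h => h13 (h12.trans h)⟩, h12, h3b⟩
  · rintro ⟨⟨h13, -⟩, h12, h3b⟩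
    exact ⟨h13, h12, h3b⟩

/-- `N₁₃ ∖ {a₁↔a₂} = N₁`. [folklore] -/
theorem cc_set_N1 (a₁ a₂ a₃ : Fin n) :
    (((openConn a₁ a₃)ᶜ : Set (BondConfig (Fin n))) \ openConn a₁ a₂) = (openConn a₁ a₂)ᶜ ∩ (openConn a₁ a₃)ᶜ := by
  ext ω
  simp only [Set.mem_sdiff, Set.mem_inter_iff, Set.mem_compl_iff]
  tauto

/-- `(N₁₃ ∩ {a₁↔o}) ∖ {a₁↔a₂} = N₁ ∩ {a₁↔o}`. [folklore] -/
theorem cc_set_N1o (o a₁ a₂ a₃ : Fin n) :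
    ((((openConn a₁ a₃)ᶜ ∩ openConn a₁ o) : Set (BondConfig (Fin n))) \ openConn a₁ a₂) =
      (openConn a₁ a₂)ᶜ ∩ (openConn a₁ a₃)ᶜ ∩ openConn a₁ o := by
  ext ω
  simp only [Set.mem_sdiff, Set.mem_inter_iff, Set.mem_compl_iff]
  tauto

/-- `N₁₂ ∩ {a₁↔a₂} = N₁₃ ∩ {a₁↔a₂}` (the glued world `W₃`). [folklore] -/
theorem cc_set_W3 (a₁ a₂ a₃ : Fin n) :
    ((openConn a₁ a₃)ᶜ ∩ (openConn a₂ a₃)ᶜ ∩ (openConn a₁ a₂ ∩ openConn a₂ a₂) : Set (BondConfig (Fin n))) =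
      (openConn a₁ a₃)ᶜ ∩ openConn a₁ a₂ := by
  ext ω
  simp only [Set.mem_inter_iff, Set.mem_compl_iff, knThm2_mem_openConn]
  constructor
  · rintro ⟨⟨h13, -⟩, h12, -⟩
    exact ⟨h13, h12⟩
  · rintro ⟨h13, h12⟩
    exact ⟨⟨h13, fun h => h13 (h12.trans h)⟩, h12, SimpleGraph.Reachable.refl _⟩

/-- `N₁₂ ∩ ({o↔A₁₂} ∩ {a₁↔a₂}) = N₁₃ ∩ {a₁↔o} ∩ {a₁↔a₂}` (observer in the glued world). [folklore] -/
theorem cc_set_W3o (o a₁ a₂ a₃ : Fin n) :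
    ((openConn a₁ a₃)ᶜ ∩ (openConn a₂ a₃)ᶜ ∩ ((openConn a₁ o ∪ openConn a₂ o) ∩ (openConn a₁ a₂ ∩ openConn a₂ a₂)) :
        Set (BondConfig (Fin n))) = ((openConn a₁ a₃)ᶜ ∩ openConn a₁ o) ∩ openConn a₁ a₂ := by
  ext ω
  simp only [Set.mem_inter_iff, Set.mem_union, Set.mem_compl_iff, knThm2_mem_openConn]
  constructor
  · rintro ⟨⟨h13, -⟩, hO, h12, -⟩
    refine ⟨⟨h13, ?_⟩, h12⟩
    rcases hO with h | h
    · exact h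
    · exact h12.trans h
  · rintro ⟨⟨h13, h1o⟩, h12⟩
    exact ⟨⟨h13, fun h => h13 (h12.trans h)⟩, Or.inl h1o, h12, SimpleGraph.Reachable.refl _⟩

/-- **Lemma 1 + Lemma 2 (KN), division-free: `P₁ P₂ · μ(W₃ ∩ {o ∈ C₁₂}) ≥ (A₁ P₂ + A₂ P₁) · μ(W₃)`**, i.e.
`φ₁₂^{W₃} ≥ φ₁₂ ≥ φ₁ + φ₂` (BHK Thm 1.3 on `N₁₂` with the increasing event `{a₁↔a₂}`, and `stub_knLemma2`).
[cite: KozmaNitzan2024, Lemma 1 (p. 5), Lemma 2 (p. 6)] -/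
theorem cc_lemma12 (w : Sym2 (Fin n) → unitInterval) (o a₁ a₂ a₃ : Fin n) (h12 : a₁ ≠ a₂) (h13 : a₁ ≠ a₃) (h23 : a₂ ≠ a₃) :
    ((prodBernoulli w).real ((openConn a₁ a₂)ᶜ ∩ (openConn a₁ a₃)ᶜ ∩ openConn a₁ o) *
          (prodBernoulli w).real ((openConn a₂ a₁)ᶜ ∩ (openConn a₂ a₃)ᶜ : Set (BondConfig (Fin n))) +
        (prodBernoulli w).real ((openConn a₂ a₁)ᶜ ∩ (openConn a₂ a₃)ᶜ ∩ openConn a₂ o) *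
          (prodBernoulli w).real ((openConn a₁ a₂)ᶜ ∩ (openConn a₁ a₃)ᶜ : Set (BondConfig (Fin n)))) *
        (prodBernoulli w).real ((openConn a₁ a₃)ᶜ ∩ openConn a₁ a₂) ≤
      (prodBernoulli w).real ((openConn a₁ a₂)ᶜ ∩ (openConn a₁ a₃)ᶜ : Set (BondConfig (Fin n))) *
        (prodBernoulli w).real ((openConn a₂ a₁)ᶜ ∩ (openConn a₂ a₃)ᶜ : Set (BondConfig (Fin n))) *
        (prodBernoulli w).real (((openConn a₁ a₃)ᶜ ∩ openConn a₁ o) ∩ openConn a₁ a₂) := by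
  -- Lemma 2: A₁' P₁₂ P₂ + A₂' P₁₂ P₁ ≤ A₁₂ P₁ P₂
  have hL := stub_knLemma2 stub_bhkSets n w o a₁ a₂ a₃ h12 h13 h23
  rw [knThm2_openConn_comm o a₁, knThm2_openConn_comm o a₂] at hL
  have e1 : (openConn a₁ o ∩ ((openConn a₁ a₂)ᶜ ∩ (openConn a₁ a₃)ᶜ) : Set (BondConfig (Fin n))) =
      (openConn a₁ a₂)ᶜ ∩ (openConn a₁ a₃)ᶜ ∩ openConn a₁ o := Set.inter_comm _ _
  have e2 : (openConn a₂ o ∩ ((openConn a₂ a₁)ᶜ ∩ (openConn a₂ a₃)ᶜ) : Set (BondConfig (Fin n))) =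
      (openConn a₂ a₁)ᶜ ∩ (openConn a₂ a₃)ᶜ ∩ openConn a₂ o := Set.inter_comm _ _
  have e3 : ((openConn a₁ o ∪ openConn a₂ o) ∩ ((openConn a₁ a₃)ᶜ ∩ (openConn a₂ a₃)ᶜ) : Set (BondConfig (Fin n))) =
      (openConn a₁ a₃)ᶜ ∩ (openConn a₂ a₃)ᶜ ∩ (openConn a₁ o ∪ openConn a₂ o) := Set.inter_comm _ _
  rw [e1, e2, e3] at hL
  -- Lemma 1: A₁₂ μ(W₃) ≤ P₁₂ μ(W₃ ∩ O)
  have i1 := knThm2_bhkOne stub_bhkSets.1 w {a₁, a₂} ({a₃} : Set (Fin n)) o a₂ (by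
    intro s hs
    simp only [Finset.mem_insert, Finset.mem_singleton] at hs
    rcases hs with rfl | rfl
    · simpa using h13
    · simpa using h23)
  rw [knThm2_sep_pair_set, Finset.set_biUnion_insert, Finset.set_biUnion_singleton, Finset.set_biInter_insert,
    Finset.set_biInter_singleton, cc_set_W3, cc_set_W3o] at i1
  -- combine: (A₁P₂ + A₂P₁) μ(W₃) P₁₂ ≤ A₁₂ P₁ P₂ μ(W₃) ≤ P₁ P₂ P₁₂ μ(W₃∩O)
  set P12 := (prodBernoulli w).real ((openConn a₁ a₃)ᶜ ∩ (openConn a₂ a₃)ᶜ : Set (BondConfig (Fin n))) with hP12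
  have hP12nn : 0 ≤ P12 := measureReal_nonneg
  have hW : 0 ≤ (prodBernoulli w).real ((openConn a₁ a₃)ᶜ ∩ openConn a₁ a₂ : Set (BondConfig (Fin n))) := measureReal_nonneg
  have hP1 : 0 ≤ (prodBernoulli w).real ((openConn a₁ a₂)ᶜ ∩ (openConn a₁ a₃)ᶜ : Set (BondConfig (Fin n))) := measureReal_nonneg
  have hP2 : 0 ≤ (prodBernoulli w).real ((openConn a₂ a₁)ᶜ ∩ (openConn a₂ a₃)ᶜ : Set (BondConfig (Fin n))) := measureReal_nonneg
  by_cases hz : P12 = 0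
  · -- then μ(W₃) = 0 (W₃ ⊆ N₁₂) and both sides vanish on the left
    have hWle : (prodBernoulli w).real ((openConn a₁ a₃)ᶜ ∩ openConn a₁ a₂ : Set (BondConfig (Fin n))) ≤ P12 := by
      rw [hP12]
      refine measureReal_mono ?_
      rintro ω ⟨h13, h12⟩
      exact ⟨h13, fun h => h13 (SimpleGraph.Reachable.trans h12 h)⟩
    have hW0 : (prodBernoulli w).real ((openConn a₁ a₃)ᶜ ∩ openConn a₁ a₂ : Set (BondConfig (Fin n))) = 0 :=
      le_antisymm (hz ▸ hWle) hW
    rw [hW0, mul_zero]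
    exact mul_nonneg (mul_nonneg hP1 hP2) measureReal_nonneg
  · have hpos : 0 < P12 := lt_of_le_of_ne hP12nn (Ne.symm hz)
    -- multiply Lemma 2 by μ(W₃) and Lemma 1 by P₁P₂, compare
    have h1 := mul_le_mul_of_nonneg_right hL hW
    have h2 := mul_le_mul_of_nonneg_left i1 (mul_nonneg hP1 hP2)
    nlinarith [h1, h2, hpos]

/-- **Arithmetic of the covariance-comparison assembly.** From (K*g), (K*t) (division-free, `φ₂ = A₂/P₂` cleared),
the Lemma-1/2 bound `P₁P₂·xOJ ≥ (A₁P₂ + A₂P₁)·eJ`, `P₁₃ = P₁ + eJ`, `eO = A₁ + xOJ`, and `τ₁ ≥ τ₃`: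
`P₂ A₁ (eg − et) + P₁ A₂ (xJg − xJt) ≤ P₁ P₂ (xOg − xOt)`. [this file] -/
theorem cc_arith {P13 P1 P2 A1 A2 eO eJ eg et xOg xOt xJg xJt xOJ : ℝ}
    (hP1 : 0 < P1) (h13 : P13 = P1 + eJ) (heO : eO = A1 + xOJ)
    (heJ : 0 ≤ eJ) (ht : et ≤ eg)
    (hKg : (P2 * eO - A2 * eJ) * eg ≤ P2 * P13 * xOg - A2 * P13 * xJg)
    (hKt : P2 * P13 * xOt - A2 * P13 * xJt ≤ (P2 * eO - A2 * eJ) * et)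
    (hL : (A1 * P2 + A2 * P1) * eJ ≤ P1 * P2 * xOJ) :
    P2 * A1 * (eg - et) + P1 * A2 * (xJg - xJt) ≤ P1 * P2 * (xOg - xOt) := by
  have hP13 : 0 < P13 := by rw [h13]; linarith
  -- P13 · [P2 (xOg - xOt) - A2 (xJg - xJt)] ≥ (P2 eO - A2 eJ)(eg - et)
  have h1 : (P2 * eO - A2 * eJ) * (eg - et) ≤ P13 * (P2 * (xOg - xOt) - A2 * (xJg - xJt)) := by nlinarith [hKg, hKt]
  -- P1 (P2 eO - A2 eJ) ≥ A1 P2 P13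
  have h2 : A1 * P2 * P13 ≤ P1 * (P2 * eO - A2 * eJ) := by
    rw [h13, heO]; nlinarith [hL]
  have h3 : A1 * P2 * P13 * (eg - et) ≤ P1 * ((P2 * eO - A2 * eJ) * (eg - et)) := by
    have := mul_le_mul_of_nonneg_right h2 (sub_nonneg.2 ht)
    linarith
  have h4 : P1 * ((P2 * eO - A2 * eJ) * (eg - et)) ≤ P1 * (P13 * (P2 * (xOg - xOt) - A2 * (xJg - xJt))) :=
    mul_le_mul_of_nonneg_left h1 hP1.le
  -- divide by P13 > 0
  have h5 : P13 * (P2 * A1 * (eg - et)) ≤ P13 * (P1 * (P2 * (xOg - xOt) - A2 * (xJg - xJt))) := by nlinarith [h3, h4]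
  have h6 := le_of_mul_le_mul_left h5 hP13
  linarith

/-! ### The assembly -/

/-- **KN Question 7 at three relays from the two HYPOTHESIS-FREE covariance comparisons (K*g), (K*t).**  Relays pairwise
distinct, `τ₃ ≤ τ₁`, `τ₃ ≤ τ₂`, `μ(M) > 0`; `hKg`, `hKt` are the division-free forms of
`Cov_{N₁₃}(1{o↔a₁} − φ₂ 1{a₁↔a₂}, 1{a₁↔b}) ≥ 0` and `Cov_{N₁₃}(1{o↔a₁} − φ₂ 1{a₁↔a₂}, 1{a₃↔b}) ≤ 0`
(`N₁₃ = {a₁ ↮ a₃}`, `φ₂ = μ(N₂ ∩ {a₂↔o})/μ(N₂)`).  Then `μ(o↔A, a₃↔b) ≤ μ(o↔A, o↔b)` (pre-FKG (3) at `a₃`).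
Proof: `[K] = Cov(Y,g) − Cov(Y,t) + (E[Y] − φ₁)(τ₁−τ₃)/μ(N₁₃)` with `E[Y] − φ₁ ≥ 0` by `cc_lemma12`; then
`preFKG3_of_observerExchange`. [cite: KozmaNitzan2024, Theorem 2 (pp. 8–9), Question 7 (p. 36)] -/
theorem preFKG3_of_covComp (w : Sym2 (Fin n) → unitInterval) (o b a₁ a₂ a₃ : Fin n)
    (h12 : a₁ ≠ a₂) (h13 : a₁ ≠ a₃) (h23 : a₂ ≠ a₃)
    (hM : 0 < (prodBernoulli w).real ((openConn a₁ a₂)ᶜ ∩ (openConn a₁ a₃)ᶜ ∩ (openConn a₂ a₃)ᶜ : Set (BondConfig (Fin n))))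
    (hτ₁ : (prodBernoulli w).real (openConn a₃ b) ≤ (prodBernoulli w).real (openConn a₁ b))
    (hτ₂ : (prodBernoulli w).real (openConn a₃ b) ≤ (prodBernoulli w).real (openConn a₂ b))
    (hKg : ((prodBernoulli w).real ((openConn a₂ a₁)ᶜ ∩ (openConn a₂ a₃)ᶜ : Set (BondConfig (Fin n))) * (prodBernoulli w).real ((openConn a₁ a₃)ᶜ ∩ openConn a₁ o) - (prodBernoulli w).real ((openConn a₂ a₁)ᶜ ∩ (openConn a₂ a₃)ᶜ ∩ openConn a₂ o) * (prodBernoulli w).real ((openConn a₁ a₃)ᶜ ∩ openConn a₁ a₂)) * (prodBernoulli w).real ((openConn a₁ a₃)ᶜ ∩ openConn a₁ b) ≤ (prodBernoulli w).real ((openConn a₂ a₁)ᶜ ∩ (openConn a₂ a₃)ᶜ : Set (BondConfig (Fin n))) * (prodBernoulli w).real ((openConn a₁ a₃)ᶜ : Set (BondConfig (Fin n))) * (prodBernoulli w).real ((openConn a₁ a₃)ᶜ ∩ (openConn a₁ o ∩ openConn a₁ b)) - (prodBernoulli w).real ((openConn a₂ a₁)ᶜ ∩ (openConn a₂ a₃)ᶜ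 ∩ openConn a₂ o) * (prodBernoulli w).real ((openConn a₁ a₃)ᶜ : Set (BondConfig (Fin n))) * (prodBernoulli w).real ((openConn a₁ a₃)ᶜ ∩ (openConn a₁ a₂ ∩ openConn a₁ b)))
    (hKt : (prodBernoulli w).real ((openConn a₂ a₁)ᶜ ∩ (openConn a₂ a₃)ᶜ : Set (BondConfig (Fin n))) * (prodBernoulli w).real ((openConn a₁ a₃)ᶜ : Set (BondConfig (Fin n))) * (prodBernoulli w).real ((openConn a₁ a₃)ᶜ ∩ (openConn a₁ o ∩ openConn a₃ b)) - (prodBernoulli w).real ((openConn a₂ a₁)ᶜ ∩ (openConn a₂ a₃)ᶜ ∩ openConn a₂ o) * (prodBernoulli w).real ((openConn a₁ a₃)ᶜ : Set (BondConfig (Fin n))) * (prodBernoulli w).real ((openConn a₁ a₃)ᶜ ∩ (openConn a₁ a₂ ∩ openConn a₃ b)) ≤ ((prodBernoulli w).real ((openConn a₂ a₁)ᶜ ∩ (openConn a₂ a₃)ᶜ : Set (BondConfig (Fin n))) * (prodBernoulli w).real ((openConn a₁ a₃)ᶜ ∩ openConn a₁ o) - (prodBernoulli w).real ((openConn a₂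 a₁)ᶜ ∩ (openConn a₂ a₃)ᶜ ∩ openConn a₂ o) * (prodBernoulli w).real ((openConn a₁ a₃)ᶜ ∩ openConn a₁ a₂)) * (prodBernoulli w).real ((openConn a₁ a₃)ᶜ ∩ openConn a₃ b)) :
    (prodBernoulli w).real ((openConn o a₁ ∪ openConn o a₂ ∪ openConn o a₃) ∩ openConn a₃ b) ≤
      (prodBernoulli w).real ((openConn o a₁ ∪ openConn o a₂ ∪ openConn o a₃) ∩ openConn o b) := by
  have hm : ∀ s : Set (BondConfig (Fin n)), MeasurableSet s := fun _ => MeasurableSet.of_discrete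
  -- P₁₃ = P₁ + eJ and eO = A₁ + xOJ
  have hs13 := measureReal_inter_add_sdiff (μ := prodBernoulli w) (s := ((openConn a₁ a₃)ᶜ : Set (BondConfig (Fin n)))) (hm (openConn a₁ a₂))
  rw [cc_set_N1] at hs13
  have hsO := measureReal_inter_add_sdiff (μ := prodBernoulli w) (s := ((openConn a₁ a₃)ᶜ ∩ openConn a₁ o : Set (BondConfig (Fin n)))) (hm (openConn a₁ a₂))
  rw [cc_set_N1o] at hsO
  -- P₁, P₂ > 0
  have hP₁ : (prodBernoulli w).real ((openConn a₁ a₂)ᶜ ∩ (openConn a₁ a₃)ᶜ ∩ (openConn a₂ a₃)ᶜ : Set (BondConfig (Fin n))) ≤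
      (prodBernoulli w).real ((openConn a₁ a₂)ᶜ ∩ (openConn a₁ a₃)ᶜ : Set (BondConfig (Fin n))) := measureReal_mono Set.inter_subset_left
  have hsub₂ : ((openConn a₁ a₂)ᶜ ∩ (openConn a₁ a₃)ᶜ ∩ (openConn a₂ a₃)ᶜ : Set (BondConfig (Fin n))) ⊆ (openConn a₂ a₁)ᶜ ∩ (openConn a₂ a₃)ᶜ := by
    intro ω hω
    simp only [Set.mem_inter_iff, Set.mem_compl_iff, knThm2_mem_openConn] at hω ⊢
    exact ⟨fun h => hω.1.1 h.symm, hω.2⟩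
  have hP₂ := measureReal_mono (μ := prodBernoulli w) hsub₂
  -- τ₁ − τ₃ = eg − et and L₁ = xOg − xOt
  have htau := cc_tau_sub w b a₁ a₃
  rw [cc_sdiff_eq, cc_sdiff_eq] at htau
  have hL1 := cc_L1_sub w o b a₁ a₃
  rw [cc_sdiff_eq, cc_sdiff_eq] at hL1
  -- Lemma 1 + 2
  have hL := cc_lemma12 w o a₁ a₂ a₃ h12 h13 h23
  have h13' : (prodBernoulli w).real ((openConn a₁ a₃)ᶜ : Set (BondConfig (Fin n))) = (prodBernoulli w).real ((openConn a₁ a₂)ᶜ ∩ (openConn a₁ a₃)ᶜ : Set (BondConfig (Fin n))) + (prodBernoulli w).real ((openConn a₁ a₃)ᶜ ∩ openConn a₁ a₂) := by linarith [hs13]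
  have heO' : (prodBernoulli w).real ((openConn a₁ a₃)ᶜ ∩ openConn a₁ o) = (prodBernoulli w).real ((openConn a₁ a₂)ᶜ ∩ (openConn a₁ a₃)ᶜ ∩ openConn a₁ o) + (prodBernoulli w).real ((openConn a₁ a₃)ᶜ ∩ openConn a₁ o ∩ openConn a₁ a₂) := by linarith [hsO]
  have htt : (prodBernoulli w).real ((openConn a₁ a₃)ᶜ ∩ openConn a₃ b) ≤ (prodBernoulli w).real ((openConn a₁ a₃)ᶜ ∩ openConn a₁ b) := by linarith [htau, hτ₁]
  have key : (prodBernoulli w).real ((openConn a₂ a₁)ᶜ ∩ (openConn a₂ a₃)ᶜ : Set (BondConfig (Fin n))) * (prodBernoulli w).real ((openConn a₁ a₂)ᶜ ∩ (openConn a₁ a₃)ᶜ ∩ openConn a₁ o) * ((prodBernoulli w).real ((openConn a₁ a₃)ᶜ ∩ openConn a₁ b) - (prodBernoulli w).real ((openConn a₁ a₃)ᶜ ∩ openConn a₃ b)) + (prodBernoulli w).real ((openConn a₁ a₂)ᶜ ∩ (openConn a₁ a₃)ᶜ : Set (BondConfig (Fin n))) * (prodBernoulli w).real ((openConn a₂ a₁)ᶜ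 ∩ (openConn a₂ a₃)ᶜ ∩ openConn a₂ o) * ((prodBernoulli w).real ((openConn a₁ a₃)ᶜ ∩ (openConn a₁ a₂ ∩ openConn a₁ b)) - (prodBernoulli w).real ((openConn a₁ a₃)ᶜ ∩ (openConn a₁ a₂ ∩ openConn a₃ b))) ≤ (prodBernoulli w).real ((openConn a₁ a₂)ᶜ ∩ (openConn a₁ a₃)ᶜ : Set (BondConfig (Fin n))) * (prodBernoulli w).real ((openConn a₂ a₁)ᶜ ∩ (openConn a₂ a₃)ᶜ : Set (BondConfig (Fin n))) * ((prodBernoulli w).real ((openConn a₁ a₃)ᶜ ∩ (openConn a₁ o ∩ openConn a₁ b)) - (prodBernoulli w).real ((openConn a₁ a₃)ᶜ ∩ (openConn a₁ o ∩ openConn a₃ b))) :=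
    cc_arith (P13 := (prodBernoulli w).real ((openConn a₁ a₃)ᶜ : Set (BondConfig (Fin n)))) (P1 := (prodBernoulli w).real ((openConn a₁ a₂)ᶜ ∩ (openConn a₁ a₃)ᶜ : Set (BondConfig (Fin n)))) (P2 := (prodBernoulli w).real ((openConn a₂ a₁)ᶜ ∩ (openConn a₂ a₃)ᶜ : Set (BondConfig (Fin n)))) (A1 := (prodBernoulli w).real ((openConn a₁ a₂)ᶜ ∩ (openConn a₁ a₃)ᶜ ∩ openConn a₁ o)) (A2 := (prodBernoulli w).real ((openConn a₂ a₁)ᶜ ∩ (openConn a₂ a₃)ᶜ ∩ openConn a₂ o)) (eO := (prodBernoulli w).real ((openConn a₁ a₃)ᶜ ∩ openConn a₁ o)) (eJ := (prodBernoulli w).real ((openConn a₁ a₃)ᶜ ∩ openConn a₁ a₂))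
      (eg := (prodBernoulli w).real ((openConn a₁ a₃)ᶜ ∩ openConn a₁ b)) (et := (prodBernoulli w).real ((openConn a₁ a₃)ᶜ ∩ openConn a₃ b)) (xOg := (prodBernoulli w).real ((openConn a₁ a₃)ᶜ ∩ (openConn a₁ o ∩ openConn a₁ b))) (xOt := (prodBernoulli w).real ((openConn a₁ a₃)ᶜ ∩ (openConn a₁ o ∩ openConn a₃ b))) (xJg := (prodBernoulli w).real ((openConn a₁ a₃)ᶜ ∩ (openConn a₁ a₂ ∩ openConn a₁ b))) (xJt := (prodBernoulli w).real ((openConn a₁ a₃)ᶜ ∩ (openConn a₁ a₂ ∩ openConn a₃ b))) (xOJ := (prodBernoulli w).real ((openConn a₁ a₃)ᶜ ∩ openConn a₁ o ∩ openConn a₁ a₂))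
      (lt_of_lt_of_le hM hP₁) h13' heO' measureReal_nonneg htt hKg hKt hL
  -- assemble the clean form of [K] and conclude
  refine preFKG3_of_observerExchange w o b a₁ a₂ a₃ h12 h23 hM hτ₁ hτ₂ ?_
  rw [hL1, htau, ← sector_m12_conn, ← cc_set_Jt]
  linarith [key]

/-- **pre-FKG (3) at `a₃` from the REGISTERED hypothesis-free stubs `stub_covCompThreeRelaysG` and
`stub_covCompThreeRelaysT` (verbatim, as hypotheses).** [cite: KozmaNitzan2024, Question 7 (p. 36)] -/
theorem preFKG3_of_stubCovComp
    (hKg : ∀ (n : ℕ) (w : Sym2 (Fin n) → unitInterval) (o b a₁ a₂ a₃ : Fin n), a₁ ≠ a₂ → a₁ ≠ a₃ → a₂ ≠ a₃ → o ≠ a₁ → o ≠ a₂ → o ≠ a₃ → b ≠ a₁ → b ≠ a₂ → b ≠ a₃ → o ≠ b → ((prodBernoulli w).real ((openConn a₂ a₁)ᶜ ∩ (openConn a₂ a₃)ᶜ : Set (BondConfig (Fin n))) * (prodBernoulli w).real ((openConn a₁ a₃)ᶜ ∩ openConn a₁ o) - (prodBernoulli w).real ((openConn a₂ a₁)ᶜ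 ∩ (openConn a₂ a₃)ᶜ ∩ openConn a₂ o) * (prodBernoulli w).real ((openConn a₁ a₃)ᶜ ∩ openConn a₁ a₂)) * (prodBernoulli w).real ((openConn a₁ a₃)ᶜ ∩ openConn a₁ b) ≤ (prodBernoulli w).real ((openConn a₂ a₁)ᶜ ∩ (openConn a₂ a₃)ᶜ : Set (BondConfig (Fin n))) * (prodBernoulli w).real ((openConn a₁ a₃)ᶜ : Set (BondConfig (Fin n))) * (prodBernoulli w).real ((openConn a₁ a₃)ᶜ ∩ (openConn a₁ o ∩ openConn a₁ b)) - (prodBernoulli w).real ((openConn a₂ a₁)ᶜ ∩ (openConn a₂ a₃)ᶜ ∩ openConn a₂ o) * (prodBernoulli w).real ((openConn a₁ a₃)ᶜ : Set (BondConfig (Fin n))) * (prodBernoulli w).real ((openConn a₁ a₃)ᶜ ∩ (openConn a₁ a₂ ∩ openConn a₁ b)))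
    (hKt : ∀ (n : ℕ) (w : Sym2 (Fin n) → unitInterval) (o b a₁ a₂ a₃ : Fin n), a₁ ≠ a₂ → a₁ ≠ a₃ → a₂ ≠ a₃ → o ≠ a₁ → o ≠ a₂ → o ≠ a₃ → b ≠ a₁ → b ≠ a₂ → b ≠ a₃ → o ≠ b → (prodBernoulli w).real ((openConn a₂ a₁)ᶜ ∩ (openConn a₂ a₃)ᶜ : Set (BondConfig (Fin n))) * (prodBernoulli w).real ((openConn a₁ a₃)ᶜ : Set (BondConfig (Fin n))) * (prodBernoulli w).real ((openConn a₁ a₃)ᶜ ∩ (openConn a₁ o ∩ openConn a₃ b)) - (prodBernoulli w).real ((openConn a₂ a₁)ᶜ ∩ (openConn a₂ a₃)ᶜ ∩ openConn a₂ o) * (prodBernoulli w).real ((openConn a₁ a₃)ᶜ : Set (BondConfig (Fin n))) * (prodBernoulli w).real ((openConn a₁ a₃)ᶜ ∩ (openConn a₁ a₂ ∩ openConn a₃ b)) ≤ ((prodBernoulli w).real ((openConn a₂ a₁)ᶜ ∩ (openConn a₂ a₃)ᶜ : Set (BondConfig (Fin n))) * (prodBernoulli w).real ((openConn a₁ a₃)ᶜ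 ∩ openConn a₁ o) - (prodBernoulli w).real ((openConn a₂ a₁)ᶜ ∩ (openConn a₂ a₃)ᶜ ∩ openConn a₂ o) * (prodBernoulli w).real ((openConn a₁ a₃)ᶜ ∩ openConn a₁ a₂)) * (prodBernoulli w).real ((openConn a₁ a₃)ᶜ ∩ openConn a₃ b))
    (w : Sym2 (Fin n) → unitInterval) (o b a₁ a₂ a₃ : Fin n)
    (h12 : a₁ ≠ a₂) (h13 : a₁ ≠ a₃) (h23 : a₂ ≠ a₃) (ho1 : o ≠ a₁) (ho2 : o ≠ a₂) (ho3 : o ≠ a₃)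
    (hb1 : b ≠ a₁) (hb2 : b ≠ a₂) (hb3 : b ≠ a₃) (hob : o ≠ b)
    (hM : 0 < (prodBernoulli w).real ((openConn a₁ a₂)ᶜ ∩ (openConn a₁ a₃)ᶜ ∩ (openConn a₂ a₃)ᶜ : Set (BondConfig (Fin n))))
    (hτ₁ : (prodBernoulli w).real (openConn a₃ b) ≤ (prodBernoulli w).real (openConn a₁ b))
    (hτ₂ : (prodBernoulli w).real (openConn a₃ b) ≤ (prodBernoulli w).real (openConn a₂ b)) :
    (prodBernoulli w).real ((openConn o a₁ ∪ openConn o a₂ ∪ openConn o a₃) ∩ openConn a₃ b) ≤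
      (prodBernoulli w).real ((openConn o a₁ ∪ openConn o a₂ ∪ openConn o a₃) ∩ openConn o b) :=
  preFKG3_of_covComp w o b a₁ a₂ a₃ h12 h13 h23 hM hτ₁ hτ₂
    (hKg n w o b a₁ a₂ a₃ h12 h13 h23 ho1 ho2 ho3 hb1 hb2 hb3 hob)
    (hKt n w o b a₁ a₂ a₃ h12 h13 h23 ho1 ho2 ho3 hb1 hb2 hb3 hob)

end

end Summit.CriticalPhenomena.PercolationContinuityZ3.Theorems
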